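import Mathlib

/-!
# `e • M` is a simple module over the corner ring `eRe` when `M` is simple (`π₁^K` over `H(G,K)`)

Blind cell `pub-hodge-repro2`, seat p8 (gen 5), Tier-5 kernel support.  The `K`-level reading of
MVW chap. 2 III.3–III.5 in `T5IsotypicProduct` / `T5IsotypicQuotAlgClosed` takes as input that
`N = π₁^K` is a SIMPLE module over the Hecke algebra `H(G₁, K) = e_K H(G₁) e_K` when `π₁` is
irreducible (stated there as prose).  This file kernel-checks the underlying algebra:

  for a ring `R`, an idempotent `e ∈ R` and an `R`-module `M`, the subgroup `e • M` is a module
  over Mathlib's corner ring `eRe` (`IsIdempotentElem.Corner`), and if `M` is simple and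
  `e • M ≠ 0` then `e • M` is a simple `eRe`-module (`isSimpleModule_cornerModule`).

Proof: a corner submodule `W ⊆ e • M` generates the `R`-submodule `R·W`, and `e • (R·W) = W`
(since `e • (r • w) = (e r e) • w` for `e`-fixed `w`); `R·W` is `⊥` or `⊤`, hence `W` is `⊥` or
`e • M`.  In the record: `R` = the (unitalised) Hecke algebra `H(G₁)`, `e = e_K` the averaging
idempotent of a compact open `K`, `eRe = H(G₁, K)`, `M = π₁` smooth irreducible, `e • M = π₁^K`.
What stays prose: the identification of smooth `G₁`-representations with non-degenerate
`H(G₁)`-modules and of `e_K • π₁` with the `K`-invariants.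

README §8(d): uses an L-value-free non-vanishing device: NO.
-/

namespace Summit.Ventures.HodgeRepro2.T5CornerSimple

variable {R : Type*} [Ring R] {e : R} (he : IsIdempotentElem e) {M : Type*} [AddCommGroup M]
  [Module R M]

omit he in
/-- The additive subgroup `e • M` of an `R`-module `M`. -/
def cornerModule (e : R) (M : Type*) [AddCommGroup M] [Module R M] : AddSubgroup M :=
  (DistribSMul.toAddMonoidHom M e).range

omit he in
/-- `x ∈ e • M ↔ ∃ m, e • m = x`. -/
theorem mem_cornerModule_iff' {x : M} : x ∈ cornerModule e M ↔ ∃ m, e • m = x :=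
  AddMonoidHom.mem_range

include he in
/-- For an idempotent `e`, `x ∈ e • M ↔ e • x = x`. -/
theorem mem_cornerModule_iff {x : M} : x ∈ cornerModule e M ↔ e • x = x := by
  rw [mem_cornerModule_iff']
  constructor
  · rintro ⟨m, rfl⟩
    rw [← mul_smul, he.eq]
  · intro h
    exact ⟨x, h⟩

include he in
/-- Elements of `e • M` are fixed by `e`. -/
theorem smul_eq_self_of_mem {x : M} (hx : x ∈ cornerModule e M) : e • x = x :=
  (mem_cornerModule_iff he).mp hx

omit he in
/-- `e • x ∈ e • M`. -/
theorem smul_mem_cornerModule (x : M) : e • x ∈ cornerModule e M :=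
  (mem_cornerModule_iff' (e := e)).mpr ⟨x, rfl⟩

/-- The element `e r e` of the corner ring. -/
def cornerElem (r : R) : he.Corner := ⟨e * r * e, r, rfl⟩

/-- `(cornerElem r).1 = e * r * e`. -/
@[simp] theorem cornerElem_val (r : R) : (cornerElem he r).1 = e * r * e := rfl

/-- Elements of the corner ring are fixed by left multiplication by `e`. -/
theorem corner_mul_left (c : he.Corner) : e * c.1 = c.1 :=
  ((Subsemigroup.mem_corner_iff he).mp c.2).1

/-- Elements of the corner ring are fixed by right multiplication by `e`. -/
theorem corner_mul_right (c : he.Corner) : c.1 * e = c.1 :=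
  ((Subsemigroup.mem_corner_iff he).mp c.2).2

/-- The corner ring maps `M` into `e • M` (in particular it acts on `e • M`). -/
theorem corner_smul_mem (c : he.Corner) (x : M) : c.1 • x ∈ cornerModule e M := by
  rw [mem_cornerModule_iff he, ← mul_smul, corner_mul_left he c]

/-- `e • M` as a module over the corner ring `eRe`. -/
instance instModuleCorner : Module he.Corner (cornerModule e M) where
  smul c x := ⟨c.1 • (x : M), corner_smul_mem he c (x : M)⟩
  one_smul x := Subtype.ext (smul_eq_self_of_mem he x.2)
  mul_smul c d x := Subtype.ext (mul_smul c.1 d.1 (x : M))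
  smul_zero c := Subtype.ext (smul_zero c.1)
  smul_add c x y := Subtype.ext (smul_add c.1 (x : M) (y : M))
  add_smul c d x := Subtype.ext (add_smul c.1 d.1 (x : M))
  zero_smul x := Subtype.ext (zero_smul R (x : M))

/-- `(c • x : e • M) = c • x` in `M`. -/
@[simp] theorem coe_corner_smul (c : he.Corner) (x : cornerModule e M) :
    ((c • x : cornerModule e M) : M) = c.1 • (x : M) := rfl

/-- The `R`-submodule of `M` generated by a corner submodule `W ⊆ e • M`. -/
def spanOf (W : Submodule he.Corner (cornerModule e M)) : Submodule R M :=
  Submodule.span R (Subtype.val '' (W : Set (cornerModule e M)))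

/-- The key step: for `x ∈ R·W` and any `r`, `e • (r • x)` lies in `W` (as an element of `M`). -/
theorem smul_mem_of_mem_spanOf (W : Submodule he.Corner (cornerModule e M)) {x : M}
    (hx : x ∈ spanOf he W) (r : R) : e • (r • x) ∈ Subtype.val '' (W : Set (cornerModule e M)) := by
  induction hx using Submodule.span_induction generalizing r with
  | mem x hx =>
    obtain ⟨w, hw, rfl⟩ := hx
    -- `e • (r • w) = (e r e) • w` for `e`-fixed `w`, and `e r e ∈ eRe`
    refine ⟨cornerElem he r • w, W.smul_mem _ hw, ?_⟩
    rw [coe_corner_smul, cornerElem_val, mul_smul, mul_smul, smul_eq_self_of_mem he w.2]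
  | zero =>
    exact ⟨0, W.zero_mem, by simp⟩
  | add x y _ _ hx hy =>
    obtain ⟨a, ha, hax⟩ := hx r
    obtain ⟨b, hb, hbx⟩ := hy r
    exact ⟨a + b, W.add_mem ha hb, by rw [AddSubgroup.coe_add, hax, hbx, smul_add, smul_add]⟩
  | smul a x _ hx =>
    obtain ⟨c, hc, hcx⟩ := hx (r * a)
    exact ⟨c, hc, by rw [hcx, mul_smul]⟩

/-- `e • (R·W) ⊆ W`. -/
theorem smul_mem_of_mem_spanOf' (W : Submodule he.Corner (cornerModule e M)) {x : M}
    (hx : x ∈ spanOf he W) : e • x ∈ Subtype.val '' (W : Set (cornerModule e M)) := by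
  simpa using smul_mem_of_mem_spanOf he W hx 1

/-- **`e • M` is simple over `eRe`.** If `M` is a simple `R`-module and `e • M ≠ 0`, then
`e • M` is a simple module over the corner ring `eRe`. -/
theorem isSimpleModule_cornerModule [IsSimpleModule R M] (hne : ∃ m : M, e • m ≠ 0) :
    IsSimpleModule he.Corner (cornerModule e M) := by
  haveI : Nontrivial (cornerModule e M) := by
    obtain ⟨m, hm⟩ := hne
    exact ⟨⟨⟨e • m, smul_mem_cornerModule (e := e) m⟩, 0, fun h => hm (congrArg Subtype.val h)⟩⟩
  refine { eq_bot_or_eq_top := fun W => ?_ }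
  rcases eq_bot_or_eq_top (spanOf he W) with h | h
  · -- `R·W = ⊥` forces `W = ⊥`
    left
    rw [eq_bot_iff]
    intro w hw
    have hmem : (w : M) ∈ spanOf he W := Submodule.subset_span ⟨w, hw, rfl⟩
    rw [h, Submodule.mem_bot] at hmem
    rw [Submodule.mem_bot]
    exact Subtype.ext hmem
  · -- `R·W = ⊤` forces `W = e • M`
    right
    rw [eq_top_iff]
    intro x _
    have hmem : (x : M) ∈ spanOf he W := by
      rw [h]
      exact Submodule.mem_top
    obtain ⟨w, hw, hwx⟩ := smul_mem_of_mem_spanOf' he W hmem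
    rw [smul_eq_self_of_mem he x.2] at hwx
    rw [← Subtype.ext hwx]
    exact hw

end Summit.Ventures.HodgeRepro2.T5CornerSimple
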